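import Summits.NavierStokesRegularity.FunctionalMining.TopEigRayleighSpectral
import Mathlib.Analysis.Convex.Deriv
import HarnessLib

/-!
# FunctionalMining — the `λ₁` / `−λ₃` moments are CONVEX along lines; `heatDissipation` is a one-sided derivative

Search for candidate a priori estimates; no regularity claim. Cell `pub-nsfunc`, prove seat
(gen 16). Kernel support for the dictionary's Lemma L-λ node (`TopEigHeatCoercive.lean`, module
docstring "WHY `heatDissipation` IS `D₀` (elementary; [ours, bookkeeping])", so far prose only):

* `TopEig.convexOn_integral_posPart_rpow_line` — for a convex continuous `g : E → ℝ`, continuous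
  `A, B : T^d → E` and `q ≥ 1`, `t ↦ ∫ (g(A + tB)⁺)^q` is convex on `ℝ`;
* `TopEig.convexOn_topEigMoment_line`, `TopEig.convexOn_negBotEigMoment_line` — hence
  `t ↦ ∫(λ₁⁺)^q (S(v + t w))` and `t ↦ ∫((−λ₃)⁺)^q (S(v + t w))` are convex for smooth `v, w`
  (`λ₁ = TopEig.lam ∘ strainFlat`, `−λ₃ = TopEig.lam ∘ (−strainFlat)`, `lam` convex, `strainFlat`
  linear in the field);
* `TopEig.heatDissipation_eq_neg_rightDeriv` — for ANY functional `Φ` convex along the line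
  `t ↦ v + tΔv`, the dictionary's `heatDissipation Φ v = sup_{t>0} (Φ v − Φ(v + tΔv))/t` IS minus the
  right derivative `−(d/dt)|_{0⁺} Φ(v + tΔv)`, which exists (Mathlib
  `ConvexOn.hasDerivWithinAt_sInf_slope_of_mem_interior`); instances for the two cores.

[ours; folklore convex analysis]
-/

noncomputable section

open MeasureTheory Set Filter Topology Finset
open scoped InnerProductSpace RealInnerProductSpace ContDiff

namespace Summit.NavierStokesRegularity.FunctionalMining

open Literature.Analysis.FunctionSpaces Literature.Analysis.FluidPDE

namespace TopEig

variable {d : Type*} [Fintype d] [DecidableEq d]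

/-! ## 1. The scalar core `r ↦ (r⁺)^q` -/

omit [Fintype d] [DecidableEq d] in
/-- `r ↦ (r⁺)^q` is monotone (`q ≥ 0`). [folklore] -/
theorem posPart_rpow_mono {q : ℝ} (hq : 0 ≤ q) {r s : ℝ} (h : r ≤ s) :
    max r 0 ^ q ≤ max s 0 ^ q :=
  Real.rpow_le_rpow (le_max_right _ _) (max_le_max h le_rfl) hq

omit [Fintype d] [DecidableEq d] in
/-- `r ↦ (r⁺)^q` is convex (`q ≥ 1`). [folklore] -/
theorem posPart_rpow_convex {q : ℝ} (hq : 1 ≤ q) (r s : ℝ) {a b : ℝ} (ha : 0 ≤ a) (hb : 0 ≤ b)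
    (hab : a + b = 1) :
    max (a * r + b * s) 0 ^ q ≤ a * max r 0 ^ q + b * max s 0 ^ q := by
  have hq0 : 0 ≤ q := by linarith
  have h1 : max (a * r + b * s) 0 ≤ a * max r 0 + b * max s 0 :=
    max_le (add_le_add (mul_le_mul_of_nonneg_left (le_max_left _ _) ha)
      (mul_le_mul_of_nonneg_left (le_max_left _ _) hb))
      (add_nonneg (mul_nonneg ha (le_max_right _ _)) (mul_nonneg hb (le_max_right _ _)))
  have h2 := (convexOn_rpow hq).2 (mem_Ici.2 (le_max_right r 0)) (mem_Ici.2 (le_max_right s 0))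
    ha hb hab
  simp only [smul_eq_mul] at h2
  exact (Real.rpow_le_rpow (le_max_right _ _) h1 hq0).trans h2

/-! ## 2. Convexity of `t ↦ ∫ (g(A + tB)⁺)^q` -/

omit [DecidableEq d] in
/-- **Convexity along lines under the integral**: for `g` convex and continuous on a real normed
space `E`, continuous `A, B : T^d → E` and `q ≥ 1`, the function `t ↦ ∫ (g(A x + t B x)⁺)^q dx` is
convex on `ℝ`. [folklore] -/
theorem convexOn_integral_posPart_rpow_line {E : Type*} [NormedAddCommGroup E] [NormedSpace ℝ E]
    {g : E → ℝ} (hg : ConvexOn ℝ univ g) (hgc : Continuous g) {A B : UnitAddTorus d → E}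
    (hA : Continuous A) (hB : Continuous B) {q : ℝ} (hq : 1 ≤ q) :
    ConvexOn ℝ univ (fun t : ℝ => ∫ x, max (g (A x + t • B x)) 0 ^ q) := by
  have hq0 : 0 ≤ q := by linarith
  have hcont : ∀ t : ℝ, Continuous fun x => max (g (A x + t • B x)) 0 ^ q := fun t =>
    ((hgc.comp (hA.add (continuous_const.smul hB))).max continuous_const).rpow_const
      fun _ => Or.inr hq0
  refine ⟨convex_univ, fun s _ t _ a b ha hb hab => ?_⟩
  simp only [smul_eq_mul]
  have hpt : ∀ x, max (g (A x + (a * s + b * t) • B x)) 0 ^ q ≤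
      a * max (g (A x + s • B x)) 0 ^ q + b * max (g (A x + t • B x)) 0 ^ q := by
    intro x
    have hlin : a • (A x + s • B x) + b • (A x + t • B x) = A x + (a * s + b * t) • B x := by
      calc a • (A x + s • B x) + b • (A x + t • B x)
          = (a + b) • A x + (a * s + b * t) • B x := by
            simp only [smul_add, smul_smul, add_smul]; abel
        _ = A x + (a * s + b * t) • B x := by rw [hab, one_smul]
    have h1 : g (A x + (a * s + b * t) • B x) ≤ a * g (A x + s • B x) + b * g (A x + t • B x) := by
      have h := hg.2 (mem_univ (A x + s • B x)) (mem_univ (A x + t • B x)) ha hb hab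
      rw [hlin] at h
      simpa only [smul_eq_mul] using h
    exact (posPart_rpow_mono hq0 h1).trans (posPart_rpow_convex hq _ _ ha hb hab)
  calc ∫ x, max (g (A x + (a * s + b * t) • B x)) 0 ^ q
      ≤ ∫ x, (a * max (g (A x + s • B x)) 0 ^ q + b * max (g (A x + t • B x)) 0 ^ q) :=
        integral_mono (hcont _).integrable_unitAddTorus
          (((hcont s).integrable_unitAddTorus.const_mul a).add
            ((hcont t).integrable_unitAddTorus.const_mul b)) hpt
    _ = a * (∫ x, max (g (A x + s • B x)) 0 ^ q) + b * (∫ x, max (g (A x + t • B x)) 0 ^ q) := by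
        rw [integral_add ((hcont s).integrable_unitAddTorus.const_mul a)
          ((hcont t).integrable_unitAddTorus.const_mul b), integral_const_mul, integral_const_mul]

/-! ## 3. The strain is linear in the field; the two eigenvalue cores along lines -/

/-- `strainFlat (v + t • w) = strainFlat v + t • strainFlat w` pointwise, for `C¹` fields. [ours] -/
theorem strainFlat_add_smul {v w : UnitAddTorus d → EuclideanSpace ℝ d} (hv : Torus.IsContDiff 1 v)
    (hw : Torus.IsContDiff 1 w) (t : ℝ) (x : UnitAddTorus d) :
    StrainL4.strainFlat (v + t • w) x = StrainL4.strainFlat v x + t • StrainL4.strainFlat w x := by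
  have htw : Torus.IsContDiff 1 (t • w) := by
    unfold Torus.IsContDiff at hw ⊢; exact hw.const_smul t
  ext p
  simp only [StrainL4.strainFlat_apply, WithLp.ofLp_add, WithLp.ofLp_smul, Pi.add_apply,
    Pi.smul_apply, smul_eq_mul]
  rw [Torus.partialDeriv_add hv htw, Torus.partialDeriv_add hv htw,
    Torus.partialDeriv_const_smul hw t, Torus.partialDeriv_const_smul hw t]
  simp only [Pi.add_apply, Pi.smul_apply, WithLp.ofLp_add, WithLp.ofLp_smul, smul_eq_mul]
  ring

/-- **`t ↦ ∫(λ₁⁺)^q (S(v + t w))` is convex** for smooth `v, w` and `q ≥ 1`. [ours] -/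
theorem convexOn_topEigMoment_line [Nonempty d] {q : ℝ} (hq : 1 ≤ q)
    {v w : UnitAddTorus d → EuclideanSpace ℝ d} (hv : Torus.IsSmooth v) (hw : Torus.IsSmooth w) :
    ConvexOn ℝ univ (fun t : ℝ => torusTopEigMoment q (v + t • w)) := by
  have hv1 : Torus.IsContDiff 1 v := hv.isContDiff (by simp)
  have hw1 : Torus.IsContDiff 1 w := hw.isContDiff (by simp)
  have h := convexOn_integral_posPart_rpow_line (d := d) convexOn_lam continuous_lam
    (StrainL4.continuous_strainFlat hv) (StrainL4.continuous_strainFlat hw) hq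
  refine h.congr fun t _ => ?_
  unfold torusTopEigMoment
  refine integral_congr_ae (ae_of_all _ fun x => ?_)
  show max (lam (StrainL4.strainFlat v x + t • StrainL4.strainFlat w x)) 0 ^ q =
    max (torusStrainTopEig (v + t • w) x) 0 ^ q
  rw [← strainFlat_add_smul hv1 hw1, lam_strainFlat]

/-- **`t ↦ ∫((−λ₃)⁺)^q (S(v + t w))` is convex** for smooth `v, w` and `q ≥ 1`. [ours] -/
theorem convexOn_negBotEigMoment_line [Nonempty d] {q : ℝ} (hq : 1 ≤ q)
    {v w : UnitAddTorus d → EuclideanSpace ℝ d} (hv : Torus.IsSmooth v) (hw : Torus.IsSmooth w) :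
    ConvexOn ℝ univ (fun t : ℝ => torusNegBotEigMoment q (v + t • w)) := by
  have hv1 : Torus.IsContDiff 1 v := hv.isContDiff (by simp)
  have hw1 : Torus.IsContDiff 1 w := hw.isContDiff (by simp)
  have hA : Continuous fun x => -StrainL4.strainFlat v x := (StrainL4.continuous_strainFlat hv).neg
  have hB : Continuous fun x => -StrainL4.strainFlat w x := (StrainL4.continuous_strainFlat hw).neg
  have h := convexOn_integral_posPart_rpow_line (d := d) convexOn_lam continuous_lam hA hB hq
  refine h.congr fun t _ => ?_
  unfold torusNegBotEigMoment
  refine integral_congr_ae (ae_of_all _ fun x => ?_)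
  show max (lam (-StrainL4.strainFlat v x + t • -StrainL4.strainFlat w x)) 0 ^ q =
    max (-torusStrainBotEig (v + t • w) x) 0 ^ q
  rw [← lam_neg_strainFlat, strainFlat_add_smul hv1 hw1, neg_add, smul_neg]

/-! ## 4. `heatDissipation` is minus the right derivative, for functionals convex along the heat line -/

omit [DecidableEq d] in
/-- **`heatDissipation Φ v = −(d/dt)|_{0⁺} Φ(v + tΔv)`** whenever `t ↦ Φ(v + tΔv)` is convex on
`ℝ`; the one-sided derivative exists. (The supremum of the difference quotients of a convex function
over `t > 0` is its value as `t → 0⁺`.) [folklore; the dictionary's "`heatDissipation` IS `D₀`"] -/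
theorem heatDissipation_eq_neg_rightDeriv {Φ : (UnitAddTorus d → EuclideanSpace ℝ d) → ℝ}
    {v : UnitAddTorus d → EuclideanSpace ℝ d}
    (hconv : ConvexOn ℝ univ (fun t : ℝ => Φ (v + t • Torus.laplacian v))) :
    HasDerivWithinAt (fun t : ℝ => Φ (v + t • Torus.laplacian v))
        (derivWithin (fun t : ℝ => Φ (v + t • Torus.laplacian v)) (Set.Ioi 0) 0) (Set.Ioi 0) 0 ∧
      heatDissipation Φ v =
        -derivWithin (fun t : ℝ => Φ (v + t • Torus.laplacian v)) (Set.Ioi 0) 0 := by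
  set g : ℝ → ℝ := fun t => Φ (v + t • Torus.laplacian v) with hg
  have h0 : (0 : ℝ) ∈ interior (univ : Set ℝ) := by simp
  refine ⟨hconv.hasDerivWithinAt_rightDeriv_of_mem_interior h0, ?_⟩
  have hg0 : g 0 = Φ v := by simp [hg]
  have hslope : ∀ t : ℝ, (Φ v - Φ (v + t • Torus.laplacian v)) / t = -slope g 0 t := by
    intro t
    rw [slope_def_field, hg0, sub_zero]
    show (Φ v - g t) / t = -((g t - Φ v) / t)
    ring
  have hset : {y : ℝ | y ∈ (univ : Set ℝ) ∧ (0 : ℝ) < y} = Set.Ioi 0 := by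
    ext y; simp
  rw [hconv.rightDeriv_eq_sInf_slope_of_mem_interior h0, hset, sInf_image', ← real_iSup_neg_eq]
  unfold heatDissipation
  exact iSup_congr fun a => hslope a

/-- The `λ₁` core: `heatDissipation (∫(λ₁⁺)^q) v` is minus the right derivative of
`t ↦ ∫(λ₁⁺)^q(S(v + tΔv))` at `0`, for smooth `v` and `q ≥ 1`. [ours] -/
theorem heatDissipation_topEigMoment_eq [Nonempty d] {q : ℝ} (hq : 1 ≤ q)
    {v : UnitAddTorus d → EuclideanSpace ℝ d} (hv : Torus.IsSmooth v) :
    HasDerivWithinAt (fun t : ℝ => torusTopEigMoment q (v + t • Torus.laplacian v))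
        (derivWithin (fun t : ℝ => torusTopEigMoment q (v + t • Torus.laplacian v)) (Set.Ioi 0) 0)
        (Set.Ioi 0) 0 ∧
      heatDissipation (torusTopEigMoment q) v =
        -derivWithin (fun t : ℝ => torusTopEigMoment q (v + t • Torus.laplacian v)) (Set.Ioi 0) 0 :=
  heatDissipation_eq_neg_rightDeriv (convexOn_topEigMoment_line hq hv hv.laplacian)

/-- The `−λ₃` core: the same for `∫((−λ₃)⁺)^q`. [ours] -/
theorem heatDissipation_negBotEigMoment_eq [Nonempty d] {q : ℝ} (hq : 1 ≤ q)
    {v : UnitAddTorus d → EuclideanSpace ℝ d} (hv : Torus.IsSmooth v) :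
    HasDerivWithinAt (fun t : ℝ => torusNegBotEigMoment q (v + t • Torus.laplacian v))
        (derivWithin (fun t : ℝ => torusNegBotEigMoment q (v + t • Torus.laplacian v)) (Set.Ioi 0) 0)
        (Set.Ioi 0) 0 ∧
      heatDissipation (torusNegBotEigMoment q) v =
        -derivWithin (fun t : ℝ => torusNegBotEigMoment q (v + t • Torus.laplacian v)) (Set.Ioi 0) 0 :=
  heatDissipation_eq_neg_rightDeriv (convexOn_negBotEigMoment_line hq hv hv.laplacian)

end TopEig

/-! ## 5. Calibration: Laplace eigenfields (single Fourier shells)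

For a smooth field with `Δv = −c v` (`c ≥ 0`; on the unit torus a single Fourier shell `|k|² = K`
has `c = (2π)²K`) the heat line is a dilation, `v + tΔv = (1 − ct) v`, the cores are `q`-homogeneous,
and `heatDissipation (∫(λ₁⁺)^q) v = q c ∫(λ₁⁺)^q(v)` exactly — the dictionary's "single-shell value
`R_q = qK`" (SIEVELD units) / `q(2π)²K` (unit torus), cf. `TopEigHeatCoercive.lean`. [ours, calibration] -/

namespace TopEig

variable {d : Type*} [Fintype d] [DecidableEq d]

/-- `λ(0) = 0`. [folklore] -/
theorem lam_zero [Nonempty d] : lam (0 : EuclideanSpace ℝ (d × d)) = 0 := by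
  have h : quad (0 : EuclideanSpace ℝ (d × d)) '' unitSphere d = {0} := by
    apply Set.eq_singleton_iff_nonempty_unique_mem.2
    refine ⟨unitSphere_nonempty.image _, ?_⟩
    rintro _ ⟨e, -, rfl⟩
    simp [quad]
  rw [lam, h, csSup_singleton]

/-- Positive homogeneity of `λ`: `λ(aA) = a λ(A)` for `a ≥ 0`. [folklore] -/
theorem lam_smul_of_nonneg [Nonempty d] {a : ℝ} (ha : 0 ≤ a) (A : EuclideanSpace ℝ (d × d)) :
    lam (a • A) = a * lam A := by
  rcases eq_or_lt_of_le ha with rfl | ha'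
  · rw [zero_smul, lam_zero, zero_mul]
  · refine le_antisymm (lam_smul_le ha A) ?_
    have h := lam_smul_le (inv_nonneg.2 ha) (a • A)
    rw [smul_smul, inv_mul_cancel₀ ha'.ne', one_smul] at h
    calc a * lam A ≤ a * (a⁻¹ * lam (a • A)) := mul_le_mul_of_nonneg_left h ha
      _ = lam (a • A) := by rw [← mul_assoc, mul_inv_cancel₀ ha'.ne', one_mul]

/-- `strainFlat (a • v) = a • strainFlat v` for `C¹` fields. [ours] -/
theorem strainFlat_smul {v : UnitAddTorus d → EuclideanSpace ℝ d} (hv : Torus.IsContDiff 1 v)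
    (a : ℝ) (x : UnitAddTorus d) :
    StrainL4.strainFlat (a • v) x = a • StrainL4.strainFlat v x := by
  have h0 : Torus.IsContDiff 1 (0 : UnitAddTorus d → EuclideanSpace ℝ d) := by
    unfold Torus.IsContDiff; exact contDiff_const
  have h := strainFlat_add_smul h0 hv a x
  rw [zero_add] at h
  rw [h]
  have hz : StrainL4.strainFlat (0 : UnitAddTorus d → EuclideanSpace ℝ d) x = 0 := by
    ext p
    simp [StrainL4.strainFlat_apply, Torus.partialDeriv, Torus.lineDeriv]
  rw [hz, zero_add]

/-- **`q`-homogeneity of the `λ₁` core**: `∫(λ₁⁺)^q(a v) = a^q ∫(λ₁⁺)^q(v)` for `a ≥ 0`. [ours] -/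
theorem torusTopEigMoment_smul [Nonempty d] (q : ℝ) {a : ℝ} (ha : 0 ≤ a)
    {v : UnitAddTorus d → EuclideanSpace ℝ d} (hv : Torus.IsSmooth v) :
    torusTopEigMoment q (a • v) = a ^ q * torusTopEigMoment q v := by
  unfold torusTopEigMoment
  rw [← integral_const_mul]
  refine integral_congr_ae (ae_of_all _ fun x => ?_)
  show max (torusStrainTopEig (a • v) x) 0 ^ q = a ^ q * max (torusStrainTopEig v x) 0 ^ q
  rw [← lam_strainFlat, ← lam_strainFlat, strainFlat_smul (hv.isContDiff (by simp)) a x,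
    lam_smul_of_nonneg ha, ← mul_zero a, ← mul_max_of_nonneg _ _ ha, mul_zero,
    Real.mul_rpow ha (le_max_right _ _)]

/-- **Calibration on Laplace eigenfields.** If `v` is smooth with `Δv = −c v`, `c ≥ 0`, then for
`q ≥ 1`: `heatDissipation (∫(λ₁⁺)^q) v = q c ∫(λ₁⁺)^q(v)` (single shell `|k|² = K` on the unit torus:
`c = (2π)²K`). [ours, calibration] -/
theorem heatDissipation_topEigMoment_of_laplacian_eq [Nonempty d] {q : ℝ} (hq : 1 ≤ q) {c : ℝ}
    (hc : 0 ≤ c) {v : UnitAddTorus d → EuclideanSpace ℝ d} (hv : Torus.IsSmooth v)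
    (hΔ : Torus.laplacian v = -(c • v)) :
    heatDissipation (torusTopEigMoment q) v = q * c * torusTopEigMoment q v := by
  obtain ⟨_, heq⟩ := heatDissipation_topEigMoment_eq hq hv
  rw [heq]
  set F : ℝ := torusTopEigMoment q v with hF
  -- along the heat line the field is the dilation `(1 - c t) • v`
  have hline : ∀ t : ℝ, v + t • Torus.laplacian v = (1 - c * t) • v := by
    intro t
    rw [hΔ, smul_neg, smul_smul, sub_smul, one_smul, sub_eq_add_neg, mul_comm]
  -- near `0⁺` the function is `(1 - c t)^q F`
  set δ : ℝ := 1 / (c + 1) with hδ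
  have hδ0 : 0 < δ := by rw [hδ]; positivity
  have hpos : ∀ t ∈ Set.Ioo (-δ) δ, 0 < 1 - c * t := by
    intro t ht
    have hct : c * t ≤ c * δ := mul_le_mul_of_nonneg_left ht.2.le hc
    have hcδ : c * δ < 1 := by
      rw [hδ, mul_one_div, div_lt_one (by positivity)]; linarith
    linarith
  have hval : ∀ t ∈ Set.Ioo (-δ) δ,
      torusTopEigMoment q (v + t • Torus.laplacian v) = (1 - c * t) ^ q * F := by
    intro t ht
    rw [hline t, torusTopEigMoment_smul q (hpos t ht).le hv]
  -- derivative of the model function at `0`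
  have hmodel : HasDerivAt (fun t : ℝ => (1 - c * t) ^ q * F) (-(q * c * F)) 0 := by
    have h1 : HasDerivAt (fun t : ℝ => 1 - c * t) (-c) 0 := by
      simpa using ((hasDerivAt_id (0 : ℝ)).const_mul c).const_sub 1
    have h2 := h1.rpow_const (p := q) (Or.inr hq)
    have e2 : -c * q * (1 - c * 0) ^ (q - 1) = -(q * c) := by
      rw [mul_zero, sub_zero, Real.one_rpow]; ring
    rw [e2] at h2
    exact (h2.mul_const F).congr_deriv (by ring)
  have hwithin : HasDerivWithinAt (fun t : ℝ => torusTopEigMoment q (v + t • Torus.laplacian v))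
      (-(q * c * F)) (Set.Ioi 0) 0 := by
    refine hmodel.hasDerivWithinAt.congr_of_eventuallyEq ?_ (hval 0 ⟨by linarith, hδ0⟩)
    have hmem : Set.Ioo (0 : ℝ) δ ∈ 𝓝[Set.Ioi 0] (0 : ℝ) := Ioo_mem_nhdsGT hδ0
    filter_upwards [hmem] with t ht
    exact hval t ⟨by linarith [ht.1], ht.2⟩
  rw [hwithin.derivWithin (uniqueDiffWithinAt_Ioi 0)]
  ring


/-- **Calibration on Laplace eigenfields, `−λ₃` core**: `Δv = −cv` (`c ≥ 0`), `q ≥ 1` ⇒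
`heatDissipation (∫((−λ₃)⁺)^q) v = q c ∫((−λ₃)⁺)^q(v)` (the `λ₁` calibration at `−v`, via the tree's
`heatDissipation_neg` / `torusTopEigMoment_neg`). [ours, calibration] -/
theorem heatDissipation_negBotEigMoment_of_laplacian_eq [Nonempty d] {q : ℝ} (hq : 1 ≤ q) {c : ℝ}
    (hc : 0 ≤ c) {v : UnitAddTorus d → EuclideanSpace ℝ d} (hv : Torus.IsSmooth v)
    (hΔ : Torus.laplacian v = -(c • v)) :
    heatDissipation (torusNegBotEigMoment q) v = q * c * torusNegBotEigMoment q v := by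
  have hΔ' : Torus.laplacian (-v) = -(c • -v) := by
    rw [torus_laplacian_neg', hΔ, smul_neg]
  have h := heatDissipation_topEigMoment_of_laplacian_eq hq hc hv.neg hΔ'
  rw [heatDissipation_neg, torusTopEigMoment_neg, ← torusNegBotEigMoment_eq_comp_neg q] at h
  exact h

end TopEig

end Summit.NavierStokesRegularity.FunctionalMining

end
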